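/-
Copyright (c) 2026 the pub-hodgecm-mathlib formalisation cell (harness21).  Prover seat hodgecm-mathlib-K2E1-p10 (g0), Track B ∕ K2-LIT, h413 = `stmt-HodgeConjecture-24833`,
line `K2_E1_TraceFormulaBeta`, campaign «EIS-WHITTAKER-3», «C2₃∕C3₃ CONCRETE» FILE F1 (dealer K2E1-plan (g5) 2026-09-04T09:23:57Z «C2₃∕C3₃ CONCRETE when (W-asm) ★»; (U3C-b) ★ p859042;
REPORT-FIRST on the K2 bus 09:5xZ): THE ψ-TWISTED LOCAL WHITTAKER TOKEN IS HOLOMORPHIC ON THE WINDOW AND BOUNDED BY THE UNTWISTED LOCAL MEAN.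
-/
import Summits.HodgeConjecture.HodgeConjecture.Theorems.K2E1WhittakerCoefficientEulerProductU3B   -- ★ B1 (K2E4-p10): the token frame, `continuous_twistedLocalFactor`, `norm_twistedLocalFactor_eq`; brings ★ LocalMeanCMU3
import Literature.Analysis.Complex.HolomorphicParametricIntegral                                     -- ★ `differentiableOn_integral_of_dominated`
import HarnessLib

/-!
# K2·E1 — `K2E1WhittakerTokenWindowU3` («C2₃ CONCRETE», hol ∕ bd): THE ψ-TWISTED LOCAL WHITTAKER TOKEN OF `U(2,1)_{L∕L⁺}` AT A FINITE PLACE IS HOLOMORPHIC IN `z` ON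
# `{σ₁ < Re z}` AND BOUNDED THERE BY THE UNTWISTED LOCAL MEAN AT `σ₁`, AS SOON AS `Q_v^{−σ₁}` IS INTEGRABLE — IN PARTICULAR ON THE WHOLE WINDOW `{1 < Re z}` AT EVERY GOOD PLACE

Track B ∕ K2-LIT, crux h413 = `stmt-HodgeConjecture-24833`, route of record `HCCMUnconditional`; cell `hodgecm-mathlib`, squad K2, ENGINE E1 (campaign «EIS-WHITTAKER-3»).
THEOREMS ONLY (no `def`, no `instance`, no notation, no named-fact hypothesis, no `sorry`; default heartbeats); lane `--supports stmt-HodgeConjecture-24833 --as helper` (count-neutral).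
Currency of ★ B1 `K2E1WhittakerCoefficientEulerProductU3B` ∕ ★ U3C `K2E1WhittakerCoefficientEulerProductU3C` (K2E4-p10, K2E2-p12): at a finite place `v` of `L⁺`, on `p : Fin 3 → L⁺_v` with
`X = Ψ_v(p₀,p₁) ∈ ∏_{w∣v} L_w` (`quadraticLocalEquiv`), the local height `Q_v(p) = ∏_{w∣v} max(1, |X_w|, |(p₂δ − ½X·X̄)_w|) ≥ 1`, the ψ-twisted local factor `f_v(p) = Q_v(p)^{−z}·∏_{w∣v} ψ_w(ξ_w X_w)`
and the TOKEN `W_v(ξ, z) = μ(𝒪_v³)⁻¹ • ∫ f_v dμ³` (the `hW` letter of ★ U3C is about exactly this expression).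

THE MATHEMATICS [TateThesis1967, §3.3; Garrett2018, §2.8; MoeglinWaldspurger1995, I.2.10].  `|f_v(p)| = Q_v(p)^{−Re z} ≤ Q_v(p)^{−σ₁}` for `Re z ≥ σ₁` (`Q_v ≥ 1`, `|ψ| = 1`), so ONE
integrable majorant `Q_v^{−σ₁}` serves the whole half-plane `{σ₁ ≤ Re z}`: the token is HOLOMORPHIC on `{σ₁ < Re z}` (holomorphy under the integral sign, ★ `differentiableOn_integral_of_dominated`)
and `‖W_v(ξ,z)‖ ≤ μ(𝒪_v³)⁻¹·∫ Q_v^{−σ₁} dμ³` there — the UNTWISTED local mean at `σ₁`, which at a GOOD place (`v` unramified in `L`, `|2|_v = 1`, all `δ_w` units) is ★ (3-iii-b1)'s local scalar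
`(1−q^{−σ₁})(1−εq^{−σ₁})(1−εq^{−(2σ₁−1)}) ∕ [(1−q^{−(σ₁−1)})(1−εq^{−(σ₁−1)})(1−εq^{−(2σ₁−2)})]`, bounded by `8 ∕ [(1−2^{−(σ₁−1)})²(1−2^{−(2σ₁−2)})]` UNIFORMLY in `q ≥ 2`, `|ε| ≤ 1`, `σ ≥ σ₁`.
These are the (hhol)∕(hbd) package letters of ★ C2₃-A `K2E1WhittakerFinitePartU3.exists_finitePart_bounds_of_packages_cm` for the concrete token (the trivial bound suffices there: a place
`v ∈ S(ξ)∖S₀` carries a weight `≥ 4`); the support letter (hvan) is FILE F2, the assembly FILE F3.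
* §1 (generic measure space) `norm_ofReal_cpow_neg_mul_le`, `differentiableOn_integral_cpow_neg_mul`, `norm_integral_cpow_neg_mul_le`, `differentiableOn_integral_cpow_neg_mul_window`;
  §2 (scalars) `norm_one_sub_mul_cpow_le_two`, `one_sub_rpow_le_norm_one_sub_mul_cpow`, `norm_localScalar_le_uniform`;
  §3 (the CM token) `differentiableOn_token_of_integrable`, `norm_token_le_of_integrable`, `differentiableOn_token_of_good`, `norm_token_le_localMean_of_good`.
HONEST LABEL: HC_CM is proved only modulo the 7 printed citations (2 remaining named inputs: hLiu418 = `stmt-HodgeConjecture-24832`, h413 = `stmt-HodgeConjecture-24833`)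
until rung 0 closes; this file asserts no named fact, closes no socket and crosses no ceiling by itself; count-neutral.
References: [TateThesis1967] J. Tate, *Fourier analysis in number fields and Hecke's zeta-functions*, §3.3 · [Garrett2018] P. Garrett, *Modern Analysis of Automorphic Forms by
Example* (2018), §2.8 · [MoeglinWaldspurger1995] C. Mœglin, J.-L. Waldspurger, *Spectral Decomposition and Eisenstein Series*, I.2.10.
-/

set_option autoImplicit false
-- the mandated namespace repeats `HodgeConjecture.HodgeConjecture`, as in every `Theorems/*.lean` of this sub-problem
set_option linter.dupNamespace false

noncomputable section

open MeasureTheory MeasureTheory.Measure NumberField IsDedekindDomain Filter Topology Set Metric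
open scoped NNReal ENNReal
open Literature.NumberTheory.Automorphic Literature.NumberTheory.Automorphic.UnitaryGroup Literature.NumberTheory.GaloisRepresentations
open Literature.NumberTheory.GaloisRepresentations.IsNonarchimedeanLocalField
open Summit.HodgeConjecture.HodgeConjecture.Cruxes.H413.K2E1WhittakerCoefficientEulerProductU3B (continuous_twistedLocalFactor norm_twistedLocalFactor_eq)
open Summit.HodgeConjecture.HodgeConjecture.Cruxes.H413.K2E1IntertwiningLocalMeanCMU3 (integrable_localHeight_rpow localMean_eq_localScalar)

namespace Summit.HodgeConjecture.HodgeConjecture.Cruxes.H413.K2E1WhittakerTokenWindowU3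

/-! ## §1 Generic: holomorphy and bounds of `z ↦ ∫ H^{−z}·χ dμ` under ONE integrable majorant `H^{−σ₁}` -/

section Generic

variable {α : Type*} [MeasurableSpace α] (μ : Measure α)

/-- `|x^{−z}·χ| ≤ x^{−σ₁}` for `x ≥ 1`, `|χ| ≤ 1`, `Re z ≥ σ₁`. [folklore] -/
theorem norm_ofReal_cpow_neg_mul_le {x : ℝ} (hx : 1 ≤ x) {c : ℂ} (hc : ‖c‖ ≤ 1) {σ₁ : ℝ} {z : ℂ} (hz : σ₁ ≤ z.re) :
    ‖((x : ℂ) ^ (-z)) * c‖ ≤ x ^ (-σ₁) := by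
  rw [norm_mul, Complex.norm_cpow_eq_rpow_re_of_pos (one_pos.trans_le hx), Complex.neg_re]
  calc x ^ (-z.re) * ‖c‖ ≤ x ^ (-z.re) * 1 := mul_le_mul_of_nonneg_left hc (Real.rpow_nonneg (zero_le_one.trans hx) _)
    _ = x ^ (-z.re) := mul_one _
    _ ≤ x ^ (-σ₁) := Real.rpow_le_rpow_of_exponent_le hx (neg_le_neg hz)

/-- **HOLOMORPHY UNDER THE INTEGRAL SIGN with one majorant**: for `H ≥ 1`, `|χ| ≤ 1`, `z ↦ H(a)^{−z}χ(a)` a.e.-strongly measurable for each `z`, and `H^{−σ₁}` integrable,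
`z ↦ ∫ H^{−z}·χ dμ` is holomorphic on `{σ₁ < Re z}` (★ `differentiableOn_integral_of_dominated`, majorant `H^{−σ₁}` on every ball inside the half-plane). [cite: Garrett2018, §2.8] -/
theorem differentiableOn_integral_cpow_neg_mul {H : α → ℝ} (h1 : ∀ a, 1 ≤ H a) {χ : α → ℂ} (hχ : ∀ a, ‖χ a‖ ≤ 1)
    (hmeas : ∀ z : ℂ, AEStronglyMeasurable (fun a => ((H a : ℂ) ^ (-z)) * χ a) μ) {σ₁ : ℝ} (hint : Integrable (fun a => H a ^ (-σ₁)) μ) :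
    DifferentiableOn ℂ (fun z : ℂ => ∫ a, ((H a : ℂ) ^ (-z)) * χ a ∂μ) {z : ℂ | σ₁ < z.re} := by
  refine Literature.Analysis.Complex.differentiableOn_integral_of_dominated (fun z _ => hmeas z) (Eventually.of_forall fun a => ?_) fun z₀ hz₀ => ?_
  · have hH : (H a : ℂ) ≠ 0 := by exact_mod_cast (one_pos.trans_le (h1 a)).ne'
    exact ((differentiable_id.neg.const_cpow (Or.inl hH)).mul_const _).differentiableOn
  · have hz₀' : σ₁ < z₀.re := hz₀
    set R : ℝ := (z₀.re - σ₁) / 2 with hR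
    have hR0 : 0 < R := by rw [hR]; linarith
    have hball : ∀ z ∈ ball z₀ R, σ₁ ≤ z.re := fun z hz => by
      have h1' : |z.re - z₀.re| ≤ ‖z - z₀‖ := by simpa [Complex.sub_re] using Complex.abs_re_le_norm (z - z₀)
      have h2 := abs_le.mp (h1'.trans (mem_ball_iff_norm.mp hz).le)
      rw [hR] at h2; linarith [h2.1]
    refine ⟨R, hR0, fun z hz => lt_of_lt_of_le (show σ₁ < z₀.re - R by rw [hR]; linarith) ?_, _, hint, Eventually.of_forall fun a z hz => norm_ofReal_cpow_neg_mul_le (h1 a) (hχ a) (hball z hz)⟩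
    have h1' : |z.re - z₀.re| ≤ ‖z - z₀‖ := by simpa [Complex.sub_re] using Complex.abs_re_le_norm (z - z₀)
    have h2 := abs_le.mp (h1'.trans (mem_ball_iff_norm.mp hz).le)
    show z₀.re - R ≤ z.re
    linarith [h2.1]

/-- **THE TRIVIAL BOUND**: `‖∫ H^{−z}·χ dμ‖ ≤ ∫ H^{−σ₁} dμ` for `Re z ≥ σ₁` (`H ≥ 1`, `|χ| ≤ 1`, `H^{−σ₁}` integrable). [cite: TateThesis1967, §3.3] -/
theorem norm_integral_cpow_neg_mul_le {H : α → ℝ} (h1 : ∀ a, 1 ≤ H a) {χ : α → ℂ} (hχ : ∀ a, ‖χ a‖ ≤ 1) {σ₁ : ℝ}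
    (hint : Integrable (fun a => H a ^ (-σ₁)) μ) {z : ℂ} (hz : σ₁ ≤ z.re) :
    ‖∫ a, ((H a : ℂ) ^ (-z)) * χ a ∂μ‖ ≤ ∫ a, H a ^ (-σ₁) ∂μ :=
  norm_integral_le_of_norm_le hint (Eventually.of_forall fun a => norm_ofReal_cpow_neg_mul_le (h1 a) (hχ a) hz)

/-- **HOLOMORPHY ON THE WHOLE WINDOW**: if `H^{−σ}` is integrable for EVERY `σ > 1`, then `z ↦ ∫ H^{−z}·χ dμ` is holomorphic on `{1 < Re z}` (§1 at `σ₁ = (1 + Re z₀)∕2` around each `z₀`).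
[cite: Garrett2018, §2.8] -/
theorem differentiableOn_integral_cpow_neg_mul_window {H : α → ℝ} (h1 : ∀ a, 1 ≤ H a) {χ : α → ℂ} (hχ : ∀ a, ‖χ a‖ ≤ 1)
    (hmeas : ∀ z : ℂ, AEStronglyMeasurable (fun a => ((H a : ℂ) ^ (-z)) * χ a) μ) (hint : ∀ σ : ℝ, 1 < σ → Integrable (fun a => H a ^ (-σ)) μ) :
    DifferentiableOn ℂ (fun z : ℂ => ∫ a, ((H a : ℂ) ^ (-z)) * χ a ∂μ) {z : ℂ | 1 < z.re} := by
  intro z₀ hz₀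
  have hz₀' : 1 < z₀.re := hz₀
  have hσ₁ : 1 < (1 + z₀.re) / 2 := by linarith
  have hmem : z₀ ∈ {z : ℂ | (1 + z₀.re) / 2 < z.re} := by show (1 + z₀.re) / 2 < z₀.re; linarith
  have hopen : IsOpen {z : ℂ | (1 + z₀.re) / 2 < z.re} := isOpen_lt continuous_const Complex.continuous_re
  exact ((differentiableOn_integral_cpow_neg_mul μ h1 hχ hmeas (hint _ hσ₁)).differentiableAt (hopen.mem_nhds hmem)).differentiableWithinAt

end Generic

/-! ## §2 Scalars: the local scalar of ★ (3-iii-b1) is bounded uniformly in `q ≥ 2`, `|ε| ≤ 1`, `σ ≥ σ₁ > 1` -/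

section Scalars

/-- `|1 − ε·q^{−s}| ≤ 2` for `q ≥ 1` real... precisely: `q ≥ 2`, `|ε| ≤ 1`, `s ≥ 0`. [folklore] -/
theorem norm_one_sub_mul_cpow_le_two {q : ℕ} (hq : 2 ≤ q) {ε : ℂ} (hε : ‖ε‖ ≤ 1) {s : ℝ} (hs : 0 ≤ s) :
    ‖1 - ε * (q : ℂ) ^ (-(s : ℂ))‖ ≤ 2 := by
  have hq0 : 0 < (q : ℝ) := by exact_mod_cast (zero_lt_two.trans_le hq)
  have hq1 : (1 : ℝ) ≤ q := by exact_mod_cast (one_le_two.trans hq)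
  have hpow : ‖(q : ℂ) ^ (-(s : ℂ))‖ ≤ 1 := by
    rw [show (q : ℂ) = ((q : ℝ) : ℂ) by norm_cast, show (-(s : ℂ)) = ((-s : ℝ) : ℂ) by push_cast; ring, Complex.norm_cpow_eq_rpow_re_of_pos hq0,
      Complex.ofReal_re]
    exact Real.rpow_le_one_of_one_le_of_nonpos hq1 (by linarith)
  calc ‖1 - ε * (q : ℂ) ^ (-(s : ℂ))‖ ≤ ‖(1 : ℂ)‖ + ‖ε * (q : ℂ) ^ (-(s : ℂ))‖ := norm_sub_le _ _
    _ = 1 + ‖ε‖ * ‖(q : ℂ) ^ (-(s : ℂ))‖ := by rw [norm_one, norm_mul]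
    _ ≤ 1 + 1 * 1 := by gcongr
    _ = 2 := by norm_num

/-- `1 − 2^{−s₁} ≤ |1 − ε·q^{−s}|` for `q ≥ 2`, `|ε| ≤ 1`, `0 ≤ s₁ ≤ s`. [folklore] -/
theorem one_sub_rpow_le_norm_one_sub_mul_cpow {q : ℕ} (hq : 2 ≤ q) {ε : ℂ} (hε : ‖ε‖ ≤ 1) {s₁ s : ℝ} (hs₁ : 0 ≤ s₁) (hs : s₁ ≤ s) :
    1 - (2 : ℝ) ^ (-s₁) ≤ ‖1 - ε * (q : ℂ) ^ (-(s : ℂ))‖ := by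
  have hq0 : 0 < (q : ℝ) := by exact_mod_cast (zero_lt_two.trans_le hq)
  have hq2 : (2 : ℝ) ≤ q := by exact_mod_cast hq
  have hpow : ‖(q : ℂ) ^ (-(s : ℂ))‖ = (q : ℝ) ^ (-s) := by
    rw [show (q : ℂ) = ((q : ℝ) : ℂ) by norm_cast, show (-(s : ℂ)) = ((-s : ℝ) : ℂ) by push_cast; ring, Complex.norm_cpow_eq_rpow_re_of_pos hq0,
      Complex.ofReal_re]
  have hle : (q : ℝ) ^ (-s) ≤ (2 : ℝ) ^ (-s₁) :=
    (Real.rpow_le_rpow_of_nonpos two_pos hq2 (by linarith)).trans (Real.rpow_le_rpow_of_exponent_le one_le_two (by linarith))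
  calc 1 - (2 : ℝ) ^ (-s₁) ≤ 1 - ‖ε * (q : ℂ) ^ (-(s : ℂ))‖ := by
        rw [norm_mul, hpow]
        have : ‖ε‖ * (q : ℝ) ^ (-s) ≤ 1 * (2 : ℝ) ^ (-s₁) := by gcongr
        linarith
    _ = ‖(1 : ℂ)‖ - ‖ε * (q : ℂ) ^ (-(s : ℂ))‖ := by rw [norm_one]
    _ ≤ ‖1 - ε * (q : ℂ) ^ (-(s : ℂ))‖ := norm_sub_norm_le _ _

/-- **THE LOCAL SCALAR IS BOUNDED UNIFORMLY IN THE PLACE**: for `q ≥ 2`, `|ε| ≤ 1`, `1 < σ₁ ≤ σ`: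
`|(1−q^{−σ})(1−εq^{−σ})(1−εq^{−(2σ−1)}) ∕ [(1−q^{−(σ−1)})(1−εq^{−(σ−1)})(1−εq^{−(2σ−2)})]| ≤ 8 ∕ [(1−2^{−(σ₁−1)})²·(1−2^{−(2σ₁−2)})]` (numerator `≤ 2³`, each denominator factor
`≥` its value at `q = 2`, `σ = σ₁`). [folklore] -/
theorem norm_localScalar_le_uniform {q : ℕ} (hq : 2 ≤ q) {ε : ℂ} (hε : ‖ε‖ ≤ 1) {σ₁ σ : ℝ} (hσ₁ : 1 < σ₁) (hσ : σ₁ ≤ σ) :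
    ‖(1 - (q : ℂ) ^ (-(σ : ℂ))) * (1 - ε * (q : ℂ) ^ (-(σ : ℂ))) * (1 - ε * (q : ℂ) ^ (-(2 * (σ : ℂ) - 1))) /
        ((1 - (q : ℂ) ^ (-((σ : ℂ) - 1))) * (1 - ε * (q : ℂ) ^ (-((σ : ℂ) - 1))) * (1 - ε * (q : ℂ) ^ (-(2 * (σ : ℂ) - 2))))‖ ≤
      8 / ((1 - (2 : ℝ) ^ (-(σ₁ - 1))) ^ 2 * (1 - (2 : ℝ) ^ (-(2 * σ₁ - 2)))) := by
  have h1ε : ‖(1 : ℂ)‖ ≤ 1 := by rw [norm_one]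
  -- exponents as real casts
  have e1 : (-(σ : ℂ)) = -((σ : ℝ) : ℂ) := rfl
  have e2 : (-(2 * (σ : ℂ) - 1)) = -(((2 * σ - 1 : ℝ)) : ℂ) := by push_cast; ring
  have e3 : (-((σ : ℂ) - 1)) = -(((σ - 1 : ℝ)) : ℂ) := by push_cast; ring
  have e4 : (-(2 * (σ : ℂ) - 2)) = -(((2 * σ - 2 : ℝ)) : ℂ) := by push_cast; ring
  -- numerator ≤ 8
  have hn1 : ‖1 - (q : ℂ) ^ (-(σ : ℂ))‖ ≤ 2 := by
    have := norm_one_sub_mul_cpow_le_two hq h1ε (s := σ) (by linarith); rwa [one_mul] at this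
  have hn2 : ‖1 - ε * (q : ℂ) ^ (-(σ : ℂ))‖ ≤ 2 := norm_one_sub_mul_cpow_le_two hq hε (by linarith)
  have hn3 : ‖1 - ε * (q : ℂ) ^ (-(2 * (σ : ℂ) - 1))‖ ≤ 2 := by rw [e2]; exact norm_one_sub_mul_cpow_le_two hq hε (by linarith)
  -- denominator ≥ (1−2^{−(σ₁−1)})²(1−2^{−(2σ₁−2)})
  have hA : 0 < 1 - (2 : ℝ) ^ (-(σ₁ - 1)) := by
    have : (2 : ℝ) ^ (-(σ₁ - 1)) < 1 := Real.rpow_lt_one_of_one_lt_of_neg one_lt_two (by linarith)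
    linarith
  have hB : 0 < 1 - (2 : ℝ) ^ (-(2 * σ₁ - 2)) := by
    have : (2 : ℝ) ^ (-(2 * σ₁ - 2)) < 1 := Real.rpow_lt_one_of_one_lt_of_neg one_lt_two (by linarith)
    linarith
  have hd1 : 1 - (2 : ℝ) ^ (-(σ₁ - 1)) ≤ ‖1 - (q : ℂ) ^ (-((σ : ℂ) - 1))‖ := by
    have := one_sub_rpow_le_norm_one_sub_mul_cpow hq h1ε (s₁ := σ₁ - 1) (s := σ - 1) (by linarith) (by linarith); rwa [one_mul, ← e3] at this
  have hd2 : 1 - (2 : ℝ) ^ (-(σ₁ - 1)) ≤ ‖1 - ε * (q : ℂ) ^ (-((σ : ℂ) - 1))‖ := by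
    rw [e3]; exact one_sub_rpow_le_norm_one_sub_mul_cpow hq hε (by linarith) (by linarith)
  have hd3 : 1 - (2 : ℝ) ^ (-(2 * σ₁ - 2)) ≤ ‖1 - ε * (q : ℂ) ^ (-(2 * (σ : ℂ) - 2))‖ := by
    rw [e4]; exact one_sub_rpow_le_norm_one_sub_mul_cpow hq hε (by linarith) (by linarith)
  have hden : (1 - (2 : ℝ) ^ (-(σ₁ - 1))) ^ 2 * (1 - (2 : ℝ) ^ (-(2 * σ₁ - 2))) ≤
      ‖(1 - (q : ℂ) ^ (-((σ : ℂ) - 1))) * (1 - ε * (q : ℂ) ^ (-((σ : ℂ) - 1))) * (1 - ε * (q : ℂ) ^ (-(2 * (σ : ℂ) - 2)))‖ := by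
    rw [norm_mul, norm_mul, sq]
    gcongr
  have hden0 : 0 < (1 - (2 : ℝ) ^ (-(σ₁ - 1))) ^ 2 * (1 - (2 : ℝ) ^ (-(2 * σ₁ - 2))) := mul_pos (pow_pos hA 2) hB
  have hnum : ‖(1 - (q : ℂ) ^ (-(σ : ℂ))) * (1 - ε * (q : ℂ) ^ (-(σ : ℂ))) * (1 - ε * (q : ℂ) ^ (-(2 * (σ : ℂ) - 1)))‖ ≤ 8 := by
    rw [norm_mul, norm_mul]
    calc ‖1 - (q : ℂ) ^ (-(σ : ℂ))‖ * ‖1 - ε * (q : ℂ) ^ (-(σ : ℂ))‖ * ‖1 - ε * (q : ℂ) ^ (-(2 * (σ : ℂ) - 1))‖ ≤ 2 * 2 * 2 := by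
          gcongr
      _ = 8 := by norm_num
  rw [norm_div]
  exact div_le_div₀ (by norm_num) hnum hden0 hden

end Scalars

/-! ## §3 The CM token: holomorphy on `{σ₁ < Re z}` and the bound by the untwisted local mean; the whole window at good places -/

section Token

variable (L : Type) [Field L] [NumberField L] [IsCMField L] {δ : L} (hcδ : IsCMField.complexConj L δ = -δ) (hδ : δ ≠ 0)
  {d : ↥(maximalRealSubfield L)} (hd : δ * δ = algebraMap ↥(maximalRealSubfield L) L d)
  (v : HeightOneSpectrum (𝓞 ↥(maximalRealSubfield L)))
  [MeasurableSpace (v.adicCompletion ↥(maximalRealSubfield L))] [BorelSpace (v.adicCompletion ↥(maximalRealSubfield L))]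
  (ν : Measure (v.adicCompletion ↥(maximalRealSubfield L))) [ν.IsAddHaarMeasure]

omit [ν.IsAddHaarMeasure] in
/-- **THE TOKEN IS HOLOMORPHIC ON `{σ₁ < Re z}` ONCE `Q_v^{−σ₁}` IS INTEGRABLE** (every finite `v`, every local frequency vector `ξw`; §1 with `H = Q_v`, `χ = ∏_w ψ_w(ξ_w X_w)`,
★ B1 `continuous_twistedLocalFactor` for measurability). [cite: Garrett2018, §2.8] [cite: TateThesis1967, §3.3] -/
theorem differentiableOn_token_of_integrable (ξw : ∀ w' : PlacesOver L v, w'.1.adicCompletion L) {σ₁ : ℝ}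
    (hint : Integrable (fun p : Fin 3 → v.adicCompletion ↥(maximalRealSubfield L) =>
        (∏ w' : PlacesOver L v, max 1 (max ((normAbs (w'.1.adicCompletion L) (quadraticLocalEquiv L v (IsCMField.complexConj L) hcδ hδ (p 0, p 1) w') : ℝ≥0) : ℝ)
          ((normAbs (w'.1.adicCompletion L) ((toLocalRing L v (p 2) * algebraMap L (LocalRing L v) δ -
            toLocalRing L v 2⁻¹ * (quadraticLocalEquiv L v (IsCMField.complexConj L) hcδ hδ (p 0, p 1) *
              conjLocal L (IsCMField.complexConj L) v (quadraticLocalEquiv L v (IsCMField.complexConj L) hcδ hδ (p 0, p 1)))) w') : ℝ≥0) : ℝ))) ^ (-σ₁))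
      (Measure.pi fun _ : Fin 3 => ν)) :
    DifferentiableOn ℂ (fun z : ℂ => ((Measure.pi fun _ : Fin 3 => ν) (integralBox ↥(maximalRealSubfield L) (Fin 3) v)).toReal⁻¹ •
      ∫ p : Fin 3 → v.adicCompletion ↥(maximalRealSubfield L),
        ((((∏ w' : PlacesOver L v, max 1 (max ((normAbs (w'.1.adicCompletion L) (quadraticLocalEquiv L v (IsCMField.complexConj L) hcδ hδ (p 0, p 1) w') : ℝ≥0) : ℝ)
          ((normAbs (w'.1.adicCompletion L) ((toLocalRing L v (p 2) * algebraMap L (LocalRing L v) δ -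
            toLocalRing L v 2⁻¹ * (quadraticLocalEquiv L v (IsCMField.complexConj L) hcδ hδ (p 0, p 1) *
              conjLocal L (IsCMField.complexConj L) v (quadraticLocalEquiv L v (IsCMField.complexConj L) hcδ hδ (p 0, p 1)))) w') : ℝ≥0) : ℝ))) : ℝ) : ℂ) ^ (-z)) *
          (∏ w' : PlacesOver L v, (adeleAddCharAt L w'.1 (ξw w' * quadraticLocalEquiv L v (IsCMField.complexConj L) hcδ hδ (p 0, p 1) w') : ℂ))
        ∂(Measure.pi fun _ : Fin 3 => ν)) {z : ℂ | σ₁ < z.re} := by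
  haveI : SecondCountableTopology (v.adicCompletion ↥(maximalRealSubfield L)) := secondCountableTopology_localField _
  have hχ : ∀ p : Fin 3 → v.adicCompletion ↥(maximalRealSubfield L),
      ‖∏ w' : PlacesOver L v, (adeleAddCharAt L w'.1 (ξw w' * quadraticLocalEquiv L v (IsCMField.complexConj L) hcδ hδ (p 0, p 1) w') : ℂ)‖ ≤ 1 := fun p => by
    rw [norm_prod]
    exact Finset.prod_le_one (fun w' _ => norm_nonneg _) fun w' _ => (Circle.norm_coe _).le
  have h := differentiableOn_integral_cpow_neg_mul (Measure.pi fun _ : Fin 3 => ν) (fun p => Finset.one_le_prod fun w' _ => le_max_left _ _)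
    hχ (fun z => (continuous_twistedLocalFactor L hcδ hδ v z ξw).aestronglyMeasurable) hint
  exact h.const_smul (((Measure.pi fun _ : Fin 3 => ν) (integralBox ↥(maximalRealSubfield L) (Fin 3) v)).toReal⁻¹)

omit [BorelSpace (v.adicCompletion ↥(maximalRealSubfield L))] [ν.IsAddHaarMeasure] in
/-- **THE TOKEN IS BOUNDED BY THE UNTWISTED LOCAL MEAN**: `‖W_v(ξ,z)‖ ≤ μ(𝒪_v³)⁻¹ · ∫ Q_v^{−σ₁} dμ³` for `Re z ≥ σ₁`, once `Q_v^{−σ₁}` is integrable (every finite `v`, every `ξw`).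
[cite: TateThesis1967, §3.3] [cite: MoeglinWaldspurger1995, I.2.10] -/
theorem norm_token_le_of_integrable (ξw : ∀ w' : PlacesOver L v, w'.1.adicCompletion L) {σ₁ : ℝ}
    (hint : Integrable (fun p : Fin 3 → v.adicCompletion ↥(maximalRealSubfield L) =>
        (∏ w' : PlacesOver L v, max 1 (max ((normAbs (w'.1.adicCompletion L) (quadraticLocalEquiv L v (IsCMField.complexConj L) hcδ hδ (p 0, p 1) w') : ℝ≥0) : ℝ)
          ((normAbs (w'.1.adicCompletion L) ((toLocalRing L v (p 2) * algebraMap L (LocalRing L v) δ -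
            toLocalRing L v 2⁻¹ * (quadraticLocalEquiv L v (IsCMField.complexConj L) hcδ hδ (p 0, p 1) *
              conjLocal L (IsCMField.complexConj L) v (quadraticLocalEquiv L v (IsCMField.complexConj L) hcδ hδ (p 0, p 1)))) w') : ℝ≥0) : ℝ))) ^ (-σ₁))
      (Measure.pi fun _ : Fin 3 => ν)) {z : ℂ} (hz : σ₁ ≤ z.re) :
    ‖((Measure.pi fun _ : Fin 3 => ν) (integralBox ↥(maximalRealSubfield L) (Fin 3) v)).toReal⁻¹ •
      ∫ p : Fin 3 → v.adicCompletion ↥(maximalRealSubfield L),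
        ((((∏ w' : PlacesOver L v, max 1 (max ((normAbs (w'.1.adicCompletion L) (quadraticLocalEquiv L v (IsCMField.complexConj L) hcδ hδ (p 0, p 1) w') : ℝ≥0) : ℝ)
          ((normAbs (w'.1.adicCompletion L) ((toLocalRing L v (p 2) * algebraMap L (LocalRing L v) δ -
            toLocalRing L v 2⁻¹ * (quadraticLocalEquiv L v (IsCMField.complexConj L) hcδ hδ (p 0, p 1) *
              conjLocal L (IsCMField.complexConj L) v (quadraticLocalEquiv L v (IsCMField.complexConj L) hcδ hδ (p 0, p 1)))) w') : ℝ≥0) : ℝ))) : ℝ) : ℂ) ^ (-z)) *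
          (∏ w' : PlacesOver L v, (adeleAddCharAt L w'.1 (ξw w' * quadraticLocalEquiv L v (IsCMField.complexConj L) hcδ hδ (p 0, p 1) w') : ℂ))
        ∂(Measure.pi fun _ : Fin 3 => ν)‖ ≤
      ((Measure.pi fun _ : Fin 3 => ν) (integralBox ↥(maximalRealSubfield L) (Fin 3) v)).toReal⁻¹ *
        ∫ p : Fin 3 → v.adicCompletion ↥(maximalRealSubfield L),
          (∏ w' : PlacesOver L v, max 1 (max ((normAbs (w'.1.adicCompletion L) (quadraticLocalEquiv L v (IsCMField.complexConj L) hcδ hδ (p 0, p 1) w') : ℝ≥0) : ℝ)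
            ((normAbs (w'.1.adicCompletion L) ((toLocalRing L v (p 2) * algebraMap L (LocalRing L v) δ -
              toLocalRing L v 2⁻¹ * (quadraticLocalEquiv L v (IsCMField.complexConj L) hcδ hδ (p 0, p 1) *
                conjLocal L (IsCMField.complexConj L) v (quadraticLocalEquiv L v (IsCMField.complexConj L) hcδ hδ (p 0, p 1)))) w') : ℝ≥0) : ℝ))) ^ (-σ₁)
          ∂(Measure.pi fun _ : Fin 3 => ν) := by
  rw [norm_smul, Real.norm_of_nonneg (inv_nonneg.2 ENNReal.toReal_nonneg)]
  refine mul_le_mul_of_nonneg_left ?_ (inv_nonneg.2 ENNReal.toReal_nonneg)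
  refine norm_integral_cpow_neg_mul_le (Measure.pi fun _ : Fin 3 => ν) (fun p => Finset.one_le_prod fun w' _ => le_max_left _ _) (fun p => ?_) hint hz
  rw [norm_prod]
  exact Finset.prod_le_one (fun w' _ => norm_nonneg _) fun w' _ => (Circle.norm_coe _).le

include hd in
/-- **AT A GOOD PLACE THE TOKEN IS HOLOMORPHIC ON THE WHOLE WINDOW `{1 < Re z}`** (`v` unramified in `L`, `|2|_v = 1`, all `δ_w` units, any `ξw`): `Q_v^{−σ}` is integrable for every
`σ > 1` (★ (3-iii-b1) `integrable_localHeight_rpow`), so §1 applies around every point. [cite: Garrett2018, §2.8] [cite: TateThesis1967, §3.3] -/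
theorem differentiableOn_token_of_good (hunr : Algebra.IsUnramifiedIn (𝓞 L) v.asIdeal) (h2 : Valued.v (2 : v.adicCompletion ↥(maximalRealSubfield L)) = 1)
    (hδu : ∀ w : PlacesOver L v, Valued.v (algebraMap L (LocalRing L v) δ w) = 1) (ξw : ∀ w' : PlacesOver L v, w'.1.adicCompletion L) :
    DifferentiableOn ℂ (fun z : ℂ => ((Measure.pi fun _ : Fin 3 => ν) (integralBox ↥(maximalRealSubfield L) (Fin 3) v)).toReal⁻¹ •
      ∫ p : Fin 3 → v.adicCompletion ↥(maximalRealSubfield L),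
        ((((∏ w' : PlacesOver L v, max 1 (max ((normAbs (w'.1.adicCompletion L) (quadraticLocalEquiv L v (IsCMField.complexConj L) hcδ hδ (p 0, p 1) w') : ℝ≥0) : ℝ)
          ((normAbs (w'.1.adicCompletion L) ((toLocalRing L v (p 2) * algebraMap L (LocalRing L v) δ -
            toLocalRing L v 2⁻¹ * (quadraticLocalEquiv L v (IsCMField.complexConj L) hcδ hδ (p 0, p 1) *
              conjLocal L (IsCMField.complexConj L) v (quadraticLocalEquiv L v (IsCMField.complexConj L) hcδ hδ (p 0, p 1)))) w') : ℝ≥0) : ℝ))) : ℝ) : ℂ) ^ (-z)) *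
          (∏ w' : PlacesOver L v, (adeleAddCharAt L w'.1 (ξw w' * quadraticLocalEquiv L v (IsCMField.complexConj L) hcδ hδ (p 0, p 1) w') : ℂ))
        ∂(Measure.pi fun _ : Fin 3 => ν)) {z : ℂ | 1 < z.re} := by
  haveI : SecondCountableTopology (v.adicCompletion ↥(maximalRealSubfield L)) := secondCountableTopology_localField _
  have hχ : ∀ p : Fin 3 → v.adicCompletion ↥(maximalRealSubfield L),
      ‖∏ w' : PlacesOver L v, (adeleAddCharAt L w'.1 (ξw w' * quadraticLocalEquiv L v (IsCMField.complexConj L) hcδ hδ (p 0, p 1) w') : ℂ)‖ ≤ 1 := fun p => by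
    rw [norm_prod]
    exact Finset.prod_le_one (fun w' _ => norm_nonneg _) fun w' _ => (Circle.norm_coe _).le
  have h := differentiableOn_integral_cpow_neg_mul_window (Measure.pi fun _ : Fin 3 => ν) (fun p => Finset.one_le_prod fun w' _ => le_max_left _ _)
    hχ (fun z => (continuous_twistedLocalFactor L hcδ hδ v z ξw).aestronglyMeasurable) fun σ hσ => integrable_localHeight_rpow L hcδ hδ hd v ν hunr h2 hδu hσ
  exact h.const_smul (((Measure.pi fun _ : Fin 3 => ν) (integralBox ↥(maximalRealSubfield L) (Fin 3) v)).toReal⁻¹)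

include hd in
/-- **AT A GOOD PLACE THE TOKEN IS BOUNDED BY THE LOCAL SCALAR, UNIFORMLY IN THE PLACE**: for `1 < σ₁ ≤ Re z` and any `ξw`,
`‖W_v(ξ,z)‖ ≤ 8 ∕ [(1−2^{−(σ₁−1)})²·(1−2^{−(2σ₁−2)})]` (§3 bound by the untwisted mean at `σ₁`; ★ (3-iii-b1) `localMean_eq_localScalar`; §2 with `q_v ≥ 2`, `|ε_v| ≤ 1` from
★ `isUnitary_quadraticHeckeCharCM`-style bound supplied as the hypothesis `hε`). [cite: TateThesis1967, §3.3] [cite: MoeglinWaldspurger1995, I.2.10] -/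
theorem norm_token_le_uniform_of_good (hunr : Algebra.IsUnramifiedIn (𝓞 L) v.asIdeal) (h2 : Valued.v (2 : v.adicCompletion ↥(maximalRealSubfield L)) = 1)
    (hδu : ∀ w : PlacesOver L v, Valued.v (algebraMap L (LocalRing L v) δ w) = 1) (hq : 2 ≤ v.residueCard) (hε : ‖(quadraticHeckeCharCM L).valueAtUniformizer v‖ ≤ 1)
    (ξw : ∀ w' : PlacesOver L v, w'.1.adicCompletion L) {σ₁ : ℝ} (hσ₁ : 1 < σ₁) {z : ℂ} (hz : σ₁ ≤ z.re) :
    ‖((Measure.pi fun _ : Fin 3 => ν) (integralBox ↥(maximalRealSubfield L) (Fin 3) v)).toReal⁻¹ •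
      ∫ p : Fin 3 → v.adicCompletion ↥(maximalRealSubfield L),
        ((((∏ w' : PlacesOver L v, max 1 (max ((normAbs (w'.1.adicCompletion L) (quadraticLocalEquiv L v (IsCMField.complexConj L) hcδ hδ (p 0, p 1) w') : ℝ≥0) : ℝ)
          ((normAbs (w'.1.adicCompletion L) ((toLocalRing L v (p 2) * algebraMap L (LocalRing L v) δ -
            toLocalRing L v 2⁻¹ * (quadraticLocalEquiv L v (IsCMField.complexConj L) hcδ hδ (p 0, p 1) *
              conjLocal L (IsCMField.complexConj L) v (quadraticLocalEquiv L v (IsCMField.complexConj L) hcδ hδ (p 0, p 1)))) w') : ℝ≥0) : ℝ))) : ℝ) : ℂ) ^ (-z)) *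
          (∏ w' : PlacesOver L v, (adeleAddCharAt L w'.1 (ξw w' * quadraticLocalEquiv L v (IsCMField.complexConj L) hcδ hδ (p 0, p 1) w') : ℂ))
        ∂(Measure.pi fun _ : Fin 3 => ν)‖ ≤ 8 / ((1 - (2 : ℝ) ^ (-(σ₁ - 1))) ^ 2 * (1 - (2 : ℝ) ^ (-(2 * σ₁ - 2)))) := by
  have hint := integrable_localHeight_rpow L hcδ hδ hd v ν hunr h2 hδu hσ₁
  refine (norm_token_le_of_integrable L hcδ hδ v ν ξw hint hz).trans ?_
  -- the real mean is the norm of the complex mean, which ★ (3-iii-b1) evaluates as the local scalar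
  have hmean := localMean_eq_localScalar L hcδ hδ hd v ν hunr h2 hδu hσ₁
  have hreal : ((Measure.pi fun _ : Fin 3 => ν) (integralBox ↥(maximalRealSubfield L) (Fin 3) v)).toReal⁻¹ *
      ∫ p : Fin 3 → v.adicCompletion ↥(maximalRealSubfield L),
          (∏ w' : PlacesOver L v, max 1 (max ((normAbs (w'.1.adicCompletion L) (quadraticLocalEquiv L v (IsCMField.complexConj L) hcδ hδ (p 0, p 1) w') : ℝ≥0) : ℝ)
            ((normAbs (w'.1.adicCompletion L) ((toLocalRing L v (p 2) * algebraMap L (LocalRing L v) δ -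
              toLocalRing L v 2⁻¹ * (quadraticLocalEquiv L v (IsCMField.complexConj L) hcδ hδ (p 0, p 1) *
                conjLocal L (IsCMField.complexConj L) v (quadraticLocalEquiv L v (IsCMField.complexConj L) hcδ hδ (p 0, p 1)))) w') : ℝ≥0) : ℝ))) ^ (-σ₁)
          ∂(Measure.pi fun _ : Fin 3 => ν) =
      ‖((Measure.pi fun _ : Fin 3 => ν) (integralBox ↥(maximalRealSubfield L) (Fin 3) v)).toReal⁻¹ •
        ∫ p : Fin 3 → v.adicCompletion ↥(maximalRealSubfield L),
          (((∏ w' : PlacesOver L v, max 1 (max ((normAbs (w'.1.adicCompletion L) (quadraticLocalEquiv L v (IsCMField.complexConj L) hcδ hδ (p 0, p 1) w') : ℝ≥0) : ℝ)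
            ((normAbs (w'.1.adicCompletion L) ((toLocalRing L v (p 2) * algebraMap L (LocalRing L v) δ -
              toLocalRing L v 2⁻¹ * (quadraticLocalEquiv L v (IsCMField.complexConj L) hcδ hδ (p 0, p 1) *
                conjLocal L (IsCMField.complexConj L) v (quadraticLocalEquiv L v (IsCMField.complexConj L) hcδ hδ (p 0, p 1)))) w') : ℝ≥0) : ℝ))) ^ (-σ₁) : ℝ) : ℂ)
          ∂(Measure.pi fun _ : Fin 3 => ν)‖ := by
    rw [integral_complex_ofReal, Complex.real_smul, norm_mul, Complex.norm_real, Complex.norm_real, Real.norm_of_nonneg (inv_nonneg.2 ENNReal.toReal_nonneg),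
      Real.norm_of_nonneg (integral_nonneg fun p => Real.rpow_nonneg (zero_le_one.trans (Finset.one_le_prod fun w' _ => le_max_left _ _)) _)]
  rw [hreal, hmean]
  exact norm_localScalar_le_uniform hq hε hσ₁ le_rfl

end Token

end Summit.HodgeConjecture.HodgeConjecture.Cruxes.H413.K2E1WhittakerTokenWindowU3

end
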